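import Literature.NumberTheory.Automorphic.Liu2021.Def411WeilCarriersLocalIsotypyAtPlace
import Literature.NumberTheory.Automorphic.Liu2021.Def411WeilCarriersIrreducibleOfLemD1
import Literature.NumberTheory.GelbartRogawski1991.UndoublingPlaceAssembly
import Literature.NumberTheory.GelbartRogawski1991.DoubledWeilRepresentationCMExplicit
import Literature.RepresentationTheory.Liu2021.OscillatorConventions
import Literature.NumberTheory.Automorphic.SmoothRepresentation
import Literature.NumberTheory.Automorphic.UnitaryGroupPlaceInclusion
import Literature.NumberTheory.Automorphic.UnitaryGroupLocalCongr
import Literature.NumberTheory.Automorphic.IrreducibleClassesComap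
import Literature.NumberTheory.Rogawski1990.GlobalAPacketMembership
import HarnessLib

/-!
# [GelbartRogawski1991 §3.1, §5.1; Liu2021 Def. 4.11] The CM theta-type VOCABULARY at a finite place — Liu's local theta type `X_v(μ, ε, χ_f)` of
# `U(diag dV)(L⁺_v)` named once, and the predicates «is `X_v ∘ κ_v⁻¹`-isotypic», «is a theta type», «the finite Gelbart–Rogawski dictionary»

Topic `NumberTheory/GelbartRogawski1991`; namespace `Literature.NumberTheory.GelbartRogawski1991`.  DEFINITIONS WITH BODIES ONLY (two data
abbreviations + three `Prop`-valued predicates); **no named fact, no theorem, no `sorry`, no instance, no notation**.  Cell `hodgecm-mathlib`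
(D-0151), FLOOR 0, crux H413 ∕ programme P2, DEAL (V) of F0P2-plan (g6) 2026-08-31T08:52:08Z («(b2′) SHARED VOCABULARY»): the Literature-side
SPELLING of §1 of the sub-line `Summits/HodgeConjecture/HodgeConjecture/Cruxes/H413/Lines/F0_P2PKPiRung4.lean` (v1.1, sha16 2e54cdb2dda5824f;
`IsoAtXf` :214, `ThetaTypeAt` :247, `GRDMatrix` :285), so that the two PRINTED letters it is cut into —
U′-N `WeilLiftNonsplitPrincipalSeriesConstituent.lean :: GR91Lemma512NonsplitAsPrinted` ([GelbartRogawski1991, Lem 5.1.2]: the non-split half of the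
dictionary, director s515 (2)) and D7α `XiEnvelopeNonsplitThetaType.lean :: xiEnvelope_nonsplit_isThetaType` ([Rogawski1990, Thm. 13.3.6 (c)] +
[GelbartRogawski1991, Prop. 5.2.2]: non-split rigidity, director s511∕s514 (2)) — can be STATED IN `Literature/` (which cannot import the Summits-side
★ B01 `OmegaChiSplitting.chiLocalSplittingsD` nor the Theorems lemma `F0P2cOmegaLocalType.formCongr_frame`) BY NAME over ONE shared text, and the
Summits side bridges each predicate to its Lines twin by `Iff.rfl` (`Theorems/F0P2iVocabularyBridge.lean`).  HC_CM is proved only modulo the printed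
citations until rung 0 closes; this file proves nothing and introduces no debt.

Contents (every body is a CHARACTER-FOR-CHARACTER copy of the tree text it names, with the two substitutions
`OmegaChiSplitting.chiLocalSplittingsD ⟨L⟩ ↦ chiLocalSplittingsCM L` and `formCongr_frame L H dV g hg ↦ (by rw [one_smul]; exact hg)` — proof-irrelevant):
* `chiLocalSplittingsCM L e₁ dV hdV hdV0 θ hθ ε` — Kudla's `θ`-normalised CM package of local splittings at the line `⟨ε⟩`: the all-Literature BODY of ★ B01
  `OmegaChiSplitting.chiLocalSplittingsD ⟨L⟩ e₁ dV hdV hdV0 θ hθ ε` (`CorCM/B01/Transposition/Item6OmegaChiSplitting.lean` :135–158), so that the two agree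
  by `rfl` (the desk's gen-5 twin `F0/P2/UPRIME-LiteratureTwin.v2…` spelled the same body at `θ := toHeckeCharacter μ`) [GelbartRogawski1991 §3.1 Prop. 3.1.1];
* `xThetaCM L e₁ dV hdV hdV0 μ hμ χf ε v` — **Liu's local theta type `X_v(μ, ε, χ_f)`** on `U(diag dV)(L⁺_v)`: the `χ_{f,v}`-coinvariants (`TwistedCoinv.rep` at
  `localCharOfCenter … χf v`) of the local Weil representation `(chiLocalSplittingsCM … (toHeckeCharacter μ) _ ε).omegaLoc v` of `U(diag dV ⊗ (ε))(L⁺_v)`, read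
  on `U(diag dV)(L⁺_v)` along `localLineInl` — the X′-term of `IsoAtXf` (:214–245) NAMED ONCE [Liu2021 Def. 4.11; GelbartRogawski1991 (5.1.1)];
* `IsoAtXfCM … σ μ hμ χf ε v` — «`σ ∘ inclPlace v` is `X_v(μ,ε,χf) ∘ κ_v⁻¹`-isotypic» (= `IsoAtXf`, :214);
* `ThetaTypeAtCM … μ hμ χf ε v c` — «the class `c ∈ Irr(U(H)(L⁺_v))` IS the theta type `X_v(μ,ε,χf) ∘ κ_v⁻¹`» in local-type currency (= `ThetaTypeAt`, :247);
* `GRDMatrixCM … ξ μω hμu μ hμ χf` — the finite Gelbart–Rogawski dictionary as a predicate on `(μ, χf)`: (S) split places over ★ D6 `IsXiLocalFamily` ∕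
  `cmSplitPacket`, (N) non-split places over ★ `Gqs` ∕ `cmPrincipalSeries` ∕ `cmXiTorusChar` ∕ `cmDatumLocalCongr` (= `GRDMatrix`, :285).

## References
* [GelbartRogawski1991] S. Gelbart, J. Rogawski, *L-functions and Fourier–Jacobi coefficients for the unitary group U(3)*, Invent. Math. 105 (1991):
  §3.1 Prop. 3.1.1 p. 455; §5.1 (5.1.1), Lemma 5.1.2 p. 466; Prop. 5.2.2 p. 467.
* [Liu2021] Y. Liu, *Fourier–Jacobi cycles and arithmetic relative trace formula*, Camb. J. Math. 9 (2021) = arXiv:2102.11518: Def. 4.11 (l. 2090–2096),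
  App. D §D.1 Step 2 (l. 5219).
* [Rogawski1990] J. Rogawski, Ann. of Math. Stud. 123 (1990): Lemma 4.13.1 (b) p. 62; §12.2 (2) p. 174; §13.1 p. 199.
* [PlatonovRapinchuk1994] V. Platonov, A. Rapinchuk, *Algebraic groups and number theory* (1994), §2.3 (the local congruence `κ_v`).
* [BourbakiAlgebreVIII2012] N. Bourbaki, *Algèbre VIII* (2012), §4 n°2 (isotypic components).
-/

set_option autoImplicit false

noncomputable section

open NumberField IsDedekindDomain MeasureTheory
open scoped Matrix

namespace Literature.NumberTheory.GelbartRogawski1991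

open Literature.NumberTheory Literature.NumberTheory.Automorphic Literature.NumberTheory.Automorphic.UnitaryGroup
open Literature.NumberTheory.Automorphic.IdeleClassGroup
open Literature.NumberTheory.Automorphic.Liu2021 Literature.NumberTheory.Automorphic.Liu2021.Def411WeilCarriers
open Literature.NumberTheory.Automorphic.Liu2021.Def411WeilCarriersDoubling
open Literature.NumberTheory.GelbartRogawski1991.UnitaryDualPair Literature.NumberTheory.GelbartRogawski1991.UnitaryDualPair.WeilCoinv
open Literature.NumberTheory.GelbartRogawski1991.GRConstruction
open Literature.RepresentationTheory Literature.RepresentationTheory.Liu2021 Literature.RepresentationTheory.HarrisKudlaSweet1996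
open Literature.NumberTheory.GaloisRepresentations
open Literature.NumberTheory.Rogawski1990

/-! ## §1 Data: the CM splitting package and the local theta type, named once -/

set_option synthInstance.maxHeartbeats 400000 in
set_option maxHeartbeats 8000000 in
/-- **`chiLocalSplittingsCM L e₁ dV hdV hdV0 θ hθ ε` — the `θ`-attached CM LOCAL SPLITTINGS at the line `⟨ε⟩`** (data abbreviation): Kudla's
`θ`-normalised per-place package of the doubled group `U(diag dV ⊗ (ε) ⊕ −)` (★ `cmFinLocalFamily`, Haar data of record ★ `borelPlaceMeasure`), undoubled
place by place (★ `undoubledSplittings`), read on the Gram data `(T_W ε, J_W ε)` (★ `congrW`) — Liu's `ι_{μ_v}` at every finite place as a tree term.  This is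
the BODY of the Summits-side ★ `OmegaChiSplitting.chiLocalSplittingsD ⟨L⟩ e₁ dV hdV hdV0 θ hθ ε` character for character, so that consumers rewrite one into
the other by `rfl`. [cite: GelbartRogawski1991, §3.1 Prop. 3.1.1 p. 455 L1–3] [cite: Liu2021, App. D §D.1 Step 2 (l. 5219)] -/
abbrev chiLocalSplittingsCM (L : Type) [Field L] [NumberField L] [IsCMField L] {n' : ℕ} (e₁ : Fin 3 × Fin 1 ≃ Fin n') (dV : Fin 3 → L)
    (hdV : ∀ i, IsCMField.complexConj L (dV i) = dV i) (hdV0 : ∀ i, dV i ≠ 0)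
    (θ : HeckeCharacter L) (hθ : IsSplittingChar L 1 θ) (ε : (↥(maximalRealSubfield L))ˣ) :=
  congrW L e₁ dV hdV (lineW L (TW (↥(maximalRealSubfield L)) ε)) (complexConj_lineW L (TW (↥(maximalRealSubfield L)) ε))
    (realDiagonal_lineW L (TW (↥(maximalRealSubfield L)) ε))
    (diagonal_lineW L (TW (↥(maximalRealSubfield L)) ε) (JW_eq (↥(maximalRealSubfield L)) L ε))
    (undoubledSplittings L e₁ dV hdV hdV0 (lineW L (TW (↥(maximalRealSubfield L)) ε)) (complexConj_lineW L (TW (↥(maximalRealSubfield L)) ε))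
      (lineW_ne_zero L (TW (↥(maximalRealSubfield L)) ε) (isUnit_det_TW (↥(maximalRealSubfield L)) ε)) θ (borelPlaceMeasure L)
      (cmFinLocalFamily L e₁ dV hdV hdV0 (lineW L (TW (↥(maximalRealSubfield L)) ε)) (complexConj_lineW L (TW (↥(maximalRealSubfield L)) ε))
        (lineW_ne_zero L (TW (↥(maximalRealSubfield L)) ε) (isUnit_det_TW (↥(maximalRealSubfield L)) ε)) θ
        hθ (borelPlaceMeasure L)))
    (isSymm_TW (↥(maximalRealSubfield L)) ε) (JW_eq (↥(maximalRealSubfield L)) L ε)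

set_option synthInstance.maxHeartbeats 400000 in
set_option maxHeartbeats 8000000 in
/-- **`xThetaCM L e₁ dV hdV hdV0 μ hμ χf ε v` — LIU'S LOCAL THETA TYPE `X_v(μ, ε, χ_f)`** (data abbreviation), a representation of
`U(diag dV)(L⁺_v)` (★ `localPi L c̄ 3 (diagonal dV) v`): the `χ_{f,v}`-coinvariants (★ `TwistedCoinv.rep` at ★ `localCharOfCenter … χf v`, the character of
the centre `U((ε))(L⁺_v) = E¹_v` of the rank-one factor) of the local Weil representation `(chiLocalSplittingsCM … (toHeckeCharacter μ) _ ε).omegaLoc v` of the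
pair `U(diag dV) × U((ε))` at the conjugate-symplectic `μ`, read on `U(diag dV)(L⁺_v)` along ★ `localLineInl` («`k ↦ k ⊗ 1`»).  `χf` is a PLAIN character of
`U(1)(𝔸_{L⁺,f})` (automorphy is not part of the local type).  This is the X′-term of the sub-line predicate `IsoAtXf` named ONCE; «the members of `Π(ξ_v)`
occur in the Weil representation» is said about THIS object. [cite: Liu2021, Def. 4.11 (l. 2090–2096)] [cite: GelbartRogawski1991, §5.1 (5.1.1), Lem 5.1.2 p. 466] -/
abbrev xThetaCM (L : Type) [Field L] [NumberField L] [IsCMField L] {n' : ℕ} (e₁ : Fin 3 × Fin 1 ≃ Fin n') (dV : Fin 3 → L)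
    (hdV : ∀ i, IsCMField.complexConj L (dV i) = dV i) (hdV0 : ∀ i, dV i ≠ 0)
    (μ : Literature.NumberTheory.Automorphic.IdeleClassGroup L →ₜ* Circle) (hμ : IsConjugateSymplectic L μ)
    (χf : UnitaryGroup.finAdelicOne (↥(maximalRealSubfield L)) L (IsCMField.complexConj L) →* ℂˣ) (ε : (↥(maximalRealSubfield L))ˣ)
    (v : HeightOneSpectrum (𝓞 ↥(maximalRealSubfield L))) :=
  (show Representation ℂ (localPi L (IsCMField.complexConj L) 3 (Matrix.diagonal dV) v) _ from
  (TwistedCoinv.rep (localCharOfCenter (↥(maximalRealSubfield L)) L (IsCMField.complexConj L)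
      (JW (↥(maximalRealSubfield L)) L ε) (JW_apply_ne_zero (↥(maximalRealSubfield L)) L ε) χf v)
    ((chiLocalSplittingsCM L e₁ dV hdV hdV0 (toHeckeCharacter L μ) ((isOscillatorChar_toHeckeCharacter_iff μ).mpr hμ) ε).omegaLoc v)
    (commute_omegaLoc_localCenter (↥(maximalRealSubfield L)) L (IsCMField.complexConj L) 3 e₁ (Matrix.diagonal dV)
      (JW (↥(maximalRealSubfield L)) L ε) (complexConj_imagUnit L) (imagUnit_ne_zero L) (imagUnit_mul_self L)
      (realDiagonal_isSymm L dV hdV) (isSymm_TW (↥(maximalRealSubfield L)) ε) (realDiagonal_map L dV hdV).symm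
      (JW_eq (↥(maximalRealSubfield L)) L ε) (JW_apply_ne_zero (↥(maximalRealSubfield L)) L ε)
      (chiLocalSplittingsCM L e₁ dV hdV hdV0 (toHeckeCharacter L μ) ((isOscillatorChar_toHeckeCharacter_iff μ).mpr hμ) ε) v)).comp
    (UnitaryGroup.localLineInl L (IsCMField.complexConj L) 3 e₁ (Matrix.diagonal dV) (JW (↥(maximalRealSubfield L)) L ε) v))

/-! ## §2 Predicates: «is `X_v ∘ κ_v⁻¹`-isotypic», «is a theta type», «the finite Gelbart–Rogawski dictionary» -/

set_option synthInstance.maxHeartbeats 400000 in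
set_option maxHeartbeats 8000000 in
/-- **`IsoAtXfCM … σ μ hμ χf ε v`** — «`σ ∘ inclPlace v` is `X_v(μ, ε, χ_f) ∘ κ_v⁻¹`-isotypic»: for a representation `σ` of `U(H)(𝔸_{L⁺,f})` and a
rational frame `ᵗ(c̄ g) H g = diag dV` (`hg`), the `ℂ[U(H)(L⁺_v)]`-module of `σ ∘ inclPlace v` IS the isotypic component of `xThetaCM … μ hμ χf ε v` pulled back
along the local congruence `κ_v⁻¹ : U(H)(L⁺_v) ≃ U(diag dV)(L⁺_v)` (★ `localCongr`, `u ↦ g_v u g_v⁻¹`; the congruence proof is the frame relation with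
`1 • H = H`).  Token-identical to the sub-line's `IsoAtXf` (v1.1 :214) after unfolding the two abbreviations of §1 — the Summits bridge is `Iff.rfl`.
[cite: Liu2021, Def. 4.11 (l. 2090–2096)] [cite: GelbartRogawski1991, Lem 5.1.2 p. 466] [cite: PlatonovRapinchuk1994, §2.3] -/
def IsoAtXfCM (L : Type) [Field L] [NumberField L] [IsCMField L] (H : Matrix (Fin 3) (Fin 3) L) {n' : ℕ} (e₁ : Fin 3 × Fin 1 ≃ Fin n') (dV : Fin 3 → L)
    (hdV : ∀ i, IsCMField.complexConj L (dV i) = dV i) (hdV0 : ∀ i, dV i ≠ 0) (g : GL (Fin 3) L)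
    (hg : ((g : Matrix (Fin 3) (Fin 3) L).map (cmConjRingHom L))ᵀ * H * (g : Matrix (Fin 3) (Fin 3) L) = Matrix.diagonal dV)
    {W : Type} [AddCommGroup W] [Module ℂ W] (σ : Representation ℂ (finAdelic (↥(maximalRealSubfield L)) L (IsCMField.complexConj L) 3 H) W)
    (μ : Literature.NumberTheory.Automorphic.IdeleClassGroup L →ₜ* Circle) (hμ : IsConjugateSymplectic L μ)
    (χf : UnitaryGroup.finAdelicOne (↥(maximalRealSubfield L)) L (IsCMField.complexConj L) →* ℂˣ) (ε : (↥(maximalRealSubfield L))ˣ)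
    (v : HeightOneSpectrum (𝓞 ↥(maximalRealSubfield L))) : Prop :=
  isotypicComponent (MonoidAlgebra ℂ (localPi L (IsCMField.complexConj L) 3 H v))
    (Representation.asModule (σ.comp (inclPlace (↥(maximalRealSubfield L)) L (IsCMField.complexConj L) 3 H v)))
    (Representation.asModule
      ((xThetaCM L e₁ dV hdV hdV0 μ hμ χf ε v :
          localPi L (IsCMField.complexConj L) 3 (Matrix.diagonal dV) v →* _).comp
        (localCongr L (IsCMField.complexConj L) g one_ne_zero
          (by rw [one_smul]; exact hg) v).symm.toMulEquiv.toMonoidHom)) = ⊤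

set_option synthInstance.maxHeartbeats 400000 in
set_option maxHeartbeats 8000000 in
/-- **`ThetaTypeAtCM … μ hμ χf ε v c`** — «the class `c ∈ Irr(U(H)(L⁺_v))` (★ D6 carrier `(cmDatum L 3 H).Local v`, read on `localPi … v` through
★ `localPiEquiv v`) IS the theta type `X_v(μ, ε, χ_f) ∘ κ_v⁻¹`», in LOCAL-TYPE currency: for every irreducible `τ` on `T : Type` of which the pulled-back class
is a constituent, every `τ`-isotypic representation `ρ′` of `U(H)(L⁺_v)` is `X_v(μ,ε,χf) ∘ κ_v⁻¹`-isotypic.  Token-identical to the sub-line's `ThetaTypeAt`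
(v1.1 :247) after unfolding §1 — the Summits bridge is `Iff.rfl`.  «The members of `Π(ξ_v)` occur in the Weil representation.»
[cite: GelbartRogawski1991, §5.1 (5.1.1), Lem 5.1.2 p. 466] [cite: BourbakiAlgebreVIII2012, VIII §4 n°2] -/
def ThetaTypeAtCM (L : Type) [Field L] [NumberField L] [IsCMField L] (H : Matrix (Fin 3) (Fin 3) L) {n' : ℕ} (e₁ : Fin 3 × Fin 1 ≃ Fin n') (dV : Fin 3 → L)
    (hdV : ∀ i, IsCMField.complexConj L (dV i) = dV i) (hdV0 : ∀ i, dV i ≠ 0) (g : GL (Fin 3) L)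
    (hg : ((g : Matrix (Fin 3) (Fin 3) L).map (cmConjRingHom L))ᵀ * H * (g : Matrix (Fin 3) (Fin 3) L) = Matrix.diagonal dV)
    (μ : Literature.NumberTheory.Automorphic.IdeleClassGroup L →ₜ* Circle) (hμ : IsConjugateSymplectic L μ)
    (χf : UnitaryGroup.finAdelicOne (↥(maximalRealSubfield L)) L (IsCMField.complexConj L) →* ℂˣ) (ε : (↥(maximalRealSubfield L))ˣ)
    (v : HeightOneSpectrum (𝓞 ↥(maximalRealSubfield L))) (c : IrrClass ((cmDatum L 3 H).Local v)) : Prop :=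
  ∀ (T : Type) [AddCommGroup T] [Module ℂ T] (τ : Representation ℂ ↥(localPi L (IsCMField.complexConj L) 3 H v) T), τ.IsIrreducible →
    (IrrClass.comap (localPiEquiv L (IsCMField.complexConj L) 3 H v) c).IsConstituentOf τ →
    ∀ (W' : Type) [AddCommGroup W'] [Module ℂ W'] (ρ' : Representation ℂ ↥(localPi L (IsCMField.complexConj L) 3 H v) W'),
      isotypicComponent (MonoidAlgebra ℂ (localPi L (IsCMField.complexConj L) 3 H v)) (Representation.asModule ρ')
          (Representation.asModule τ) = ⊤ →
      isotypicComponent (MonoidAlgebra ℂ (localPi L (IsCMField.complexConj L) 3 H v)) (Representation.asModule ρ')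
        (Representation.asModule
          ((xThetaCM L e₁ dV hdV hdV0 μ hμ χf ε v :
          localPi L (IsCMField.complexConj L) 3 (Matrix.diagonal dV) v →* _).comp
            (localCongr L (IsCMField.complexConj L) g one_ne_zero
              (by rw [one_smul]; exact hg) v).symm.toMulEquiv.toMonoidHom)) = ⊤

set_option synthInstance.maxHeartbeats 400000 in
set_option maxHeartbeats 8000000 in
/-- **`GRDMatrixCM … ξ μω hμu μ hμ χf` — THE FINITE GELBART–ROGAWSKI DICTIONARY as a predicate on the pair `(μ, χf)`** relative to
`ξ = (η, ψ)` (★ D5 `OneDimAutRepH`) and Rogawski's auxiliary `μω`: (S) at a place `v` SPLIT in `L`, every member of every ξ-local family `Pv` (★ D6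
`IsXiLocalFamily`; there `Pv v` is the singleton ★ `cmSplitPacket` `{i_G(ξ_w ⊗ μ_w∘det₀)}`) is a `(μ,χf)`-theta type of some line class
[Rogawski1990 Lemma 4.13.1 (b)]; (N) at a NON-SPLIT `v`, for every form congruence `ᵗT̄·H_v·T = a·Φ₃` (the D6 binders verbatim), SOME constituent
`x₀ ∈ JH(i_G(χ_ξ))` (★ `cmPrincipalSeries` at ★ `cmXiTorusChar`) transported along ★ `cmDatumLocalCongr` is a `(μ,χf)`-theta type of some line class — in
print `x₀ = πⁿ(ξ_v)`, the Weil-representation lift [GelbartRogawski1991 (5.1.1), Lem 5.1.2].  Token-identical to the sub-line's `GRDMatrix` (v1.1 :285)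
with `ThetaTypeAt ↦ ThetaTypeAtCM` — the Summits bridge is `Iff.rfl`.  No Haar measure, no `π²`∕`πˢ` label, `ε` always «∃».
[cite: GelbartRogawski1991, §5.1 (5.1.1), Lem 5.1.2 p. 466] [cite: Rogawski1990, Lemma 4.13.1 (b) p. 62; §12.2 (2) p. 174; §13.1 p. 199] -/
def GRDMatrixCM (L : Type) [Field L] [NumberField L] [IsCMField L] (H : Matrix (Fin 3) (Fin 3) L) (hH : (H.map (cmConjRingHom L))ᵀ = H) (hHd : IsUnit H.det)
    {n' : ℕ} (e₁ : Fin 3 × Fin 1 ≃ Fin n') (dV : Fin 3 → L) (hdV : ∀ i, IsCMField.complexConj L (dV i) = dV i) (hdV0 : ∀ i, dV i ≠ 0) (g : GL (Fin 3) L)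
    (hg : ((g : Matrix (Fin 3) (Fin 3) L).map (cmConjRingHom L))ᵀ * H * (g : Matrix (Fin 3) (Fin 3) L) = Matrix.diagonal dV)
    (ξ : OneDimAutRepH L) (μω : HeckeCharacter L) (hμu : μω.IsUnitary)
    (μ : Literature.NumberTheory.Automorphic.IdeleClassGroup L →ₜ* Circle) (hμ : IsConjugateSymplectic L μ)
    (χf : UnitaryGroup.finAdelicOne (↥(maximalRealSubfield L)) L (IsCMField.complexConj L) →* ℂˣ) : Prop :=
  (∀ Pv : ∀ v : HeightOneSpectrum (𝓞 ↥(maximalRealSubfield L)), CMLocalAPacket L H v,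
      ξ.IsXiLocalFamily hH hHd μω hμu Pv →
      ∀ (v : HeightOneSpectrum (𝓞 ↥(maximalRealSubfield L))),
        (∃ w : PlacesOver L v, IsCMField.complexConj L • w.1 ≠ w.1) →
        ∀ c : IrrClass ((cmDatum L 3 H).Local v), c ∈ (Pv v).members →
          ∃ ε : (↥(maximalRealSubfield L))ˣ, ThetaTypeAtCM L H e₁ dV hdV hdV0 g hg μ hμ χf ε v c) ∧
  (∀ (v : HeightOneSpectrum (𝓞 ↥(maximalRealSubfield L))),
      (∀ w : PlacesOver L v, IsCMField.complexConj L • w.1 = w.1) →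
      ∀ (T : GL (Fin 3) (UnitaryGroup.LocalRing L v)) (a : UnitaryGroup.LocalRing L v) (ha : IsUnit a)
        (h : formCongr (conjLocal L (IsCMField.complexConj L) v) T (H.map (algebraMap L (UnitaryGroup.LocalRing L v))) =
          a • (Matrix.of fun i j : Fin 3 => if i.val + j.val + 1 = 3 then (1 : L) else 0).map (algebraMap L (UnitaryGroup.LocalRing L v))),
        ∃ x₀ : IrrClass (Gqs L v),
          x₀.IsConstituentOf (cmPrincipalSeries L 3 v (cmXiTorusChar L v (μω.semilocalComponent L v)
            (torusLocalComponent L (IsCMField.complexConj L) v ξ.η) (torusLocalComponent L (IsCMField.complexConj L) v ξ.ψ))) ∧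
          ∃ ε : (↥(maximalRealSubfield L))ˣ,
            ThetaTypeAtCM L H e₁ dV hdV hdV0 g hg μ hμ χf ε v (IrrClass.comap (cmDatumLocalCongr L v T ha h).symm x₀))

end Literature.NumberTheory.GelbartRogawski1991

end
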